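import Literature.Topology.FourManifolds.KhCurlIncidence
import Literature.Topology.FourManifolds.KhCurlMixedSq
import Literature.Topology.FourManifolds.KhComplexHomotopyProofs
import Literature.Topology.FourManifolds.LeeXAction
import HarnessLib

/-!
# Invariance of Khovanov homology under a positive curl (first Reidemeister move, `ε = 1`)

Sibling file of `KhComplex.lean`, a brick of the invariance programme for
`Literature.Topology.FourManifolds.GaussDiagram.nonempty_iso_khovanovHomology_of_equiv`
(Khovanov (2000), Thm. 1). For every Gauss diagram `G` (realisable or not) and the positive curl
`G.curl tf 1` (`KhCurlArcs`: the target of `PolyakMove.omega1a/omega1b` with `ε = 1` at the last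
position) we prove

* `nonempty_iso_khovanovHomology_curl_one : Kh^{i,j}(G) ≅ Kh^{i,j}(G.curl tf 1)` and
* `nonempty_iso_frobeniusHomology_curl_one : H^i(G; h, t) ≅ H^i(G.curl tf 1; h, t)` over the
  universal Frobenius system, every `(R, h, t)`,

by the cancellation of Khovanov (2000), §5.2 / Bar-Natan (2002), §4 written as explicit total
homotopy data (`KhComplexHomotopyProofs.HtpyData`). With `C(D') = (C(D) ⊗ A) ⊕ C(D)` (generators
`curlLoopES s x`, `curlThruES u` of `KhCurlStates`) and the curl edge `Φ = ±m` (`KhCurlIncidence`),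
the summand `C(D) ⊗ 1` is mapped isomorphically onto `C(D)` by `Φ`; cancelling it leaves
`C(D) ⊗ X ≅ C(D)`:

* `curlPosF` — `F(s) = (s ⊗ X) - (X·s) ⊗ 1` (the correction by the action of `X` at the base
  arc, `actCoeff` of `KhActCoeff`, makes it a chain map);
* `curlPosB` — the projection onto the coefficient of `s ⊗ X`;
* `curlPosH` — `H(u) = -(-1)^{|u|} (u ⊗ 1)`, the inverse of the cancelled isomorphism;
* the identities `d F = F d` (using `sum_actCoeff_mul_incidence`: **multiplication by `X` at the
  base arc commutes with the differential**, derived from the vanishing mixed square of the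
  curl, `KhCurlMixedSq`), `d B = B d`, `B F = 1`, `F B - 1 = d H + H d`, and the degree
  bookkeeping (`F`, `B` of bidegree `(0, 0)`, `H` of bidegree `(-1, 0)`).

No planarity, no `d² = 0`, no named fact.

## References

* M. Khovanov, *A categorification of the Jones polynomial*, Duke Math. J. 101 (2000) 359–426,
  §5.2 (right-twisted curl), §5.1. [cite: Khovanov2000, §5.2]
* D. Bar-Natan, *On Khovanov's categorification of the Jones polynomial*, Algebr. Geom. Topol. 2
  (2002) 337–370, §4 (invariance under `R1`). [cite: BarNatan2002, §4]
* D. Bar-Natan, *Fast Khovanov homology computations*, J. Knot Theory Ramifications 16 (2007),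
  Lemma 4.2 (Gaussian elimination). [folklore]
-/

open Function Finset

noncomputable section

namespace Literature.Topology.FourManifolds

namespace GaussDiagram

variable {G : GaussDiagram} (tf : Bool) (ε : ℤˣ) {R : Type} [CommRing R]

/-! ## Sums over the enhanced states of the curled diagram -/

/-- `curlESEquiv⁻¹` on the left summand. [folklore] -/
@[simp]
theorem curlESEquiv_symm_inl (s : G.EnhancedState) (x : Bool) :
    (G.curlESEquiv tf ε).symm (Sum.inl (s, x)) = curlLoopES tf ε s x := rfl

/-- `curlESEquiv⁻¹` on the right summand. [folklore] -/
@[simp]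
theorem curlESEquiv_symm_inr (s : G.EnhancedState) :
    (G.curlESEquiv tf ε).symm (Sum.inr s) = curlThruES tf ε s := rfl

/-- **A sum over the enhanced states of the curled diagram** is a sum over `curlLoopES s x` and
`curlThruES u`. [folklore] -/
theorem sum_curlES {M : Type*} [AddCommMonoid M] (Φ : (G.curl tf ε).EnhancedState → M) :
    ∑ y, Φ y = ∑ s : G.EnhancedState, (Φ (curlLoopES tf ε s false) + Φ (curlLoopES tf ε s true)) +
      ∑ u : G.EnhancedState, Φ (curlThruES tf ε u) := by
  rw [← Fintype.sum_equiv (G.curlESEquiv tf ε).symm _ Φ (fun _ ↦ rfl), Fintype.sum_sum_type,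
    Fintype.sum_prod_type]
  simp only [curlESEquiv_symm_inl, curlESEquiv_symm_inr, Fintype.sum_bool, add_comm]

/-! ## Weights and Koszul signs along edges -/

/-- A nonzero incidence number raises the weight by one. [folklore] -/
theorem weight_eq_of_incidence_ne_zero {h t : R} {s u : G.EnhancedState}
    (h0 : G.incidence R h t s u ≠ 0) : u.state.weight = s.state.weight + 1 := by
  obtain ⟨i, hi, hu⟩ := exists_of_incidence_ne_zero h0
  rw [hu, State.weight_update hi]

/-- `(-1)^{|u|} ⟨d s, u⟩ = -(-1)^{|s|} ⟨d s, u⟩`. [folklore] -/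
theorem negOnePow_weight_mul_incidence (h t : R) (s u : G.EnhancedState) :
    (-1 : R) ^ u.state.weight * G.incidence R h t s u = -((-1) ^ s.state.weight * G.incidence R h t s u) := by
  by_cases h0 : G.incidence R h t s u = 0
  · rw [h0, mul_zero, mul_zero, neg_zero]
  · rw [weight_eq_of_incidence_ne_zero h0, pow_succ]; ring

/-- `(-1)^{|u|} actCoeff s u = (-1)^{|s|} actCoeff s u` (same state). [folklore] -/
theorem negOnePow_weight_mul_actCoeff (h t : R) (α : G.Arc) (x : Bool) (s u : G.EnhancedState) :
    (-1 : R) ^ u.state.weight * actCoeff R h t α x s u = (-1) ^ s.state.weight * actCoeff R h t α x s u := by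
  by_cases h0 : actCoeff R h t α x s u = 0
  · rw [h0, mul_zero, mul_zero]
  · rw [state_eq_of_actCoeff_ne_zero R h0]

/-- `(-1)^{|u|} coactCoeff s u = (-1)^{|s|} coactCoeff s u` (same state). [folklore] -/
theorem negOnePow_weight_mul_coactCoeff (h t : R) (α : G.Arc) (y : Bool) (s u : G.EnhancedState) :
    (-1 : R) ^ u.state.weight * coactCoeff R h t α y s u =
      (-1) ^ s.state.weight * coactCoeff R h t α y s u := by
  by_cases h0 : coactCoeff R h t α y s u = 0
  · rw [h0, mul_zero, mul_zero]
  · rw [state_eq_of_coactCoeff_ne_zero R h0]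

/-- `(-1)^n (-1)^n = 1`. [folklore] -/
theorem negOnePow_mul_self (n : ℕ) : (-1 : R) ^ n * (-1) ^ n = 1 := by
  rw [← mul_pow, neg_one_mul, neg_neg, one_pow]

/-! ## The total differential of the curled diagram, `ε = 1` -/

section PosD

variable (h t : R)

/-- The total differential of the positive curl at a state with the loop labelled `X`: only the
old differential on the `X`-labelled loop states. [folklore] -/
theorem totalD_curl_one_loop_true (v : (G.curl tf 1).EnhancedState → R) (u : G.EnhancedState) :
    (G.curl tf 1).totalD R h t v (curlLoopES tf 1 u true) =
      ∑ s, G.incidence R h t s u * v (curlLoopES tf 1 s true) := by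
  rw [totalD_apply, sum_curlES]
  simp only [incidence_curlLoopES_curlLoopES, Bool.false_eq_true, ↓reduceIte, zero_mul, zero_add,
    G.incidence_curlThruES_curlLoopES_of_eq_one tf 1 R rfl, Finset.sum_const_zero, add_zero]

/-- The total differential of the positive curl at a state with the loop labelled `1`. [folklore] -/
theorem totalD_curl_one_loop_false (v : (G.curl tf 1).EnhancedState → R) (u : G.EnhancedState) :
    (G.curl tf 1).totalD R h t v (curlLoopES tf 1 u false) =
      ∑ s, G.incidence R h t s u * v (curlLoopES tf 1 s false) := by
  rw [totalD_apply, sum_curlES]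
  simp only [incidence_curlLoopES_curlLoopES, ↓reduceIte, Bool.true_eq_false, zero_mul, add_zero,
    G.incidence_curlThruES_curlLoopES_of_eq_one tf 1 R rfl, Finset.sum_const_zero]

/-- The total differential of the positive curl at a state with the curl `1`-smoothed: the curl
edge (unit and multiplication by the loop label at the base arc) and the old differential.
[folklore] -/
theorem totalD_curl_one_thru (v : (G.curl tf 1).EnhancedState → R) (u : G.EnhancedState) :
    (G.curl tf 1).totalD R h t v (curlThruES tf 1 u) =
      (-1) ^ u.state.weight * v (curlLoopES tf 1 u false) +
        ∑ s, (-1) ^ s.state.weight * actCoeff R h t G.baseArc true s u * v (curlLoopES tf 1 s true) +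
          ∑ s, G.incidence R h t s u * v (curlThruES tf 1 s) := by
  rw [totalD_apply, sum_curlES]
  simp only [G.incidence_curlLoopES_curlThruES tf 1 R rfl, incidence_curlThruES_curlThruES,
    Finset.sum_add_distrib, actCoeff_false]
  congr 1
  congr 1
  rw [Finset.sum_eq_single u]
  · simp
  · intro s _ hs
    rw [if_neg (Ne.symm hs)]; ring
  · intro hu; exact absurd (Finset.mem_univ u) hu

end PosD

/-! ## Multiplication by `X` at the base arc commutes with the differential -/

/-- **Multiplication by `X` on the circle of the base arc is a chain map**:
`∑_t actCoeff(X; s → t) ⟨d t, u⟩ = ∑_t ⟨d s, t⟩ actCoeff(X; t → u)` for all enhanced states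
`s, u` of any Gauss diagram `G`. This is the vanishing of the mixed square of the positive curl
(`sum_incidence_mul_incidence_curl_eq_zero` for `G.curl tf 1`, between `s ⊗ X` and `u`), read
through the incidence numbers of `KhCurlIncidence`. Khovanov (2006), *Bar-Natan's theory and the
Rasmussen invariant* (the complex of a pointed diagram is a complex of `A`-modules); Khovanov
(2000), §5.2. [cite: Khovanov2006, §2] -/
theorem sum_actCoeff_mul_incidence (h t : R) (s u : G.EnhancedState) :
    ∑ t', actCoeff R h t G.baseArc true s t' * G.incidence R h t t' u =
      ∑ t', G.incidence R h t s t' * actCoeff R h t G.baseArc true t' u := by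
  have key := G.sum_incidence_mul_incidence_curl_eq_zero true 1 h t (curlLoopES true 1 s true)
    (curlThruES true 1 u) (by simp) (by simp)
  rw [sum_curlES] at key
  simp only [incidence_curlLoopES_curlLoopES, Bool.true_eq_false, ↓reduceIte, zero_mul, zero_add,
    G.incidence_curlLoopES_curlThruES true 1 R rfl, incidence_curlThruES_curlThruES] at key
  -- `key : ∑ t', ⟨d s,t'⟩ ((-1)^{|t'|} A(t' → u)) + ∑ t', ((-1)^{|s|} A(s → t')) ⟨d t', u⟩ = 0`
  have h1 : ∑ t', G.incidence R h t s t' * ((-1) ^ t'.state.weight * actCoeff R h t G.baseArc true t' u) =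
      -((-1) ^ s.state.weight * ∑ t', G.incidence R h t s t' * actCoeff R h t G.baseArc true t' u) := by
    rw [Finset.mul_sum, ← Finset.sum_neg_distrib]
    refine Finset.sum_congr rfl fun t' _ ↦ ?_
    have := negOnePow_weight_mul_incidence h t s t'
    linear_combination (actCoeff R h t G.baseArc true t' u) * this
  have h2 : ∑ t', (-1) ^ s.state.weight * actCoeff R h t G.baseArc true s t' * G.incidence R h t t' u =
      (-1) ^ s.state.weight * ∑ t', actCoeff R h t G.baseArc true s t' * G.incidence R h t t' u := by
    rw [Finset.mul_sum]
    exact Finset.sum_congr rfl fun t' _ ↦ by ring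
  rw [h1, h2] at key
  have h3 := negOnePow_mul_self (R := R) s.state.weight
  linear_combination (-1) ^ s.state.weight * key +
    ((∑ t', G.incidence R h t s t' * actCoeff R h t G.baseArc true t' u) -
      ∑ t', actCoeff R h t G.baseArc true s t' * G.incidence R h t t' u) * h3

/-! ## The homotopy data of the positive curl -/

section Pos

variable (G) (h t : R)

/-- **The chain map `F : C(D) → C(D')` of the positive curl**, `F(s) = (s ⊗ X) - (X·s) ⊗ 1`
(`X` acting at the base arc): on coefficient functions, `(F w)(s ⊗ X) = w s`,
`(F w)(u ⊗ 1) = -∑ₛ actCoeff(X; s → u) w s`, `(F w)(thru) = 0`. Khovanov (2000), §5.2;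
Bar-Natan (2002), §4. [cite: Khovanov2000, §5.2] -/
def curlPosF : (G.EnhancedState → R) →ₗ[R] ((G.curl tf 1).EnhancedState → R) where
  toFun w y := Sum.elim (fun p : G.EnhancedState × Bool ↦
      if p.2 then w p.1 else -∑ s, actCoeff R h t G.baseArc true s p.1 * w s)
    (fun _ ↦ (0 : R)) (G.curlESEquiv tf 1 y)
  map_add' v w := by
    funext y
    simp only [Pi.add_apply]
    generalize G.curlESEquiv tf 1 y = z
    rcases z with ⟨u, _ | _⟩ | u
    · simp only [Sum.elim_inl, Bool.false_eq_true, ↓reduceIte, mul_add, Finset.sum_add_distrib,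
        neg_add]
    · simp
    · simp
  map_smul' c v := by
    funext y
    simp only [Pi.smul_apply, smul_eq_mul, RingHom.id_apply]
    generalize G.curlESEquiv tf 1 y = z
    rcases z with ⟨u, _ | _⟩ | u
    · simp only [Sum.elim_inl, Bool.false_eq_true, ↓reduceIte, mul_neg, Finset.mul_sum, neg_inj]
      exact Finset.sum_congr rfl fun s _ ↦ by ring
    · simp
    · simp

/-- **The chain map `B : C(D') → C(D)` of the positive curl**: the coefficient of `s ⊗ X`.
Khovanov (2000), §5.2; Bar-Natan (2002), §4. [cite: Khovanov2000, §5.2] -/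
def curlPosB : ((G.curl tf 1).EnhancedState → R) →ₗ[R] (G.EnhancedState → R) where
  toFun v s := v (curlLoopES tf 1 s true)
  map_add' _ _ := rfl
  map_smul' _ _ := rfl

/-- **The homotopy `H : C(D') → C(D')` of the positive curl**, `H(u) = -(-1)^{|u|} (u ⊗ 1)` on
the `1`-smoothed curl and `0` elsewhere (minus the inverse of the cancelled isomorphism
`u ⊗ 1 ↦ (-1)^{|u|} u`): on coefficient functions `(H v)(u ⊗ 1) = -(-1)^{|u|} v(thru u)`.
Bar-Natan (2002), §4; Bar-Natan (2007), Lemma 4.2. [cite: BarNatan2002, §4] -/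
def curlPosH : ((G.curl tf 1).EnhancedState → R) →ₗ[R] ((G.curl tf 1).EnhancedState → R) where
  toFun v y := Sum.elim (fun p : G.EnhancedState × Bool ↦
      if p.2 then (0 : R) else -((-1) ^ p.1.state.weight * v (curlThruES tf 1 p.1)))
    (fun _ ↦ (0 : R)) (G.curlESEquiv tf 1 y)
  map_add' v w := by
    funext y
    simp only [Pi.add_apply]
    generalize G.curlESEquiv tf 1 y = z
    rcases z with ⟨u, _ | _⟩ | u
    · simp only [Sum.elim_inl, Bool.false_eq_true, ↓reduceIte]; ring
    · simp
    · simp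
  map_smul' c v := by
    funext y
    simp only [Pi.smul_apply, smul_eq_mul, RingHom.id_apply]
    generalize G.curlESEquiv tf 1 y = z
    rcases z with ⟨u, _ | _⟩ | u
    · simp only [Sum.elim_inl, Bool.false_eq_true, ↓reduceIte]; ring
    · simp
    · simp

variable {G h t}

/-- `F` at `s ⊗ X`. [folklore] -/
@[simp]
theorem curlPosF_loop_true (w : G.EnhancedState → R) (s : G.EnhancedState) :
    G.curlPosF tf h t w (curlLoopES tf 1 s true) = w s := by
  simp [curlPosF]

/-- `F` at `u ⊗ 1`. [folklore] -/
@[simp]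
theorem curlPosF_loop_false (w : G.EnhancedState → R) (u : G.EnhancedState) :
    G.curlPosF tf h t w (curlLoopES tf 1 u false) = -∑ s, actCoeff R h t G.baseArc true s u * w s := by
  simp [curlPosF]

/-- `F` at the `1`-smoothed curl. [folklore] -/
@[simp]
theorem curlPosF_thru (w : G.EnhancedState → R) (u : G.EnhancedState) :
    G.curlPosF tf h t w (curlThruES tf 1 u) = 0 := by
  simp [curlPosF]

/-- `B`, pointwise. [folklore] -/
@[simp]
theorem curlPosB_apply (v : (G.curl tf 1).EnhancedState → R) (s : G.EnhancedState) :
    G.curlPosB tf v s = v (curlLoopES tf 1 s true) := rfl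

/-- `H` at `s ⊗ X`. [folklore] -/
@[simp]
theorem curlPosH_loop_true (v : (G.curl tf 1).EnhancedState → R) (s : G.EnhancedState) :
    G.curlPosH tf v (curlLoopES tf 1 s true) = 0 := by
  simp [curlPosH]

/-- `H` at `u ⊗ 1`. [folklore] -/
@[simp]
theorem curlPosH_loop_false (v : (G.curl tf 1).EnhancedState → R) (u : G.EnhancedState) :
    G.curlPosH tf v (curlLoopES tf 1 u false) = -((-1) ^ u.state.weight * v (curlThruES tf 1 u)) := by
  simp [curlPosH]

/-- `H` at the `1`-smoothed curl. [folklore] -/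
@[simp]
theorem curlPosH_thru (v : (G.curl tf 1).EnhancedState → R) (u : G.EnhancedState) :
    G.curlPosH tf v (curlThruES tf 1 u) = 0 := by
  simp [curlPosH]

variable (h t)

/-- **`B F = 1`.** [folklore] -/
theorem curlPosB_curlPosF (w : G.EnhancedState → R) : G.curlPosB tf (G.curlPosF tf h t w) = w := by
  funext s; simp

/-- **`B` is a chain map**: `d (B v) = B (d' v)`. [folklore] -/
theorem totalD_curlPosB (v : (G.curl tf 1).EnhancedState → R) :
    G.totalD R h t (G.curlPosB tf v) = G.curlPosB tf ((G.curl tf 1).totalD R h t v) := by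
  funext u
  rw [curlPosB_apply, totalD_curl_one_loop_true, totalD_apply]
  rfl

/-- **`F` is a chain map**: `d' (F w) = F (d w)` — at `u ⊗ 1` this is the chain-map property of
multiplication by `X` at the base arc (`sum_actCoeff_mul_incidence`), at the `1`-smoothed curl the
unit and `X` contributions cancel. Khovanov (2000), §5.2; Bar-Natan (2002), §4. [cite: Khovanov2000, §5.2] -/
theorem totalD_curlPosF (w : G.EnhancedState → R) :
    (G.curl tf 1).totalD R h t (G.curlPosF tf h t w) = G.curlPosF tf h t (G.totalD R h t w) := by
  funext y
  rcases eq_curlLoopES_or_eq_curlThruES tf 1 y with ⟨u, x, rfl⟩ | ⟨u, rfl⟩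
  · cases x
    · -- `u ⊗ 1`: multiplication by `X` is a chain map
      rw [totalD_curl_one_loop_false, curlPosF_loop_false]
      simp only [curlPosF_loop_false, totalD_apply, mul_neg, Finset.sum_neg_distrib, Finset.mul_sum,
        neg_inj]
      rw [Finset.sum_comm]
      conv_rhs => rw [Finset.sum_comm]
      refine Finset.sum_congr rfl fun a _ ↦ ?_
      have key := congrArg (· * w a) (sum_actCoeff_mul_incidence h t a u)
      simp only [Finset.sum_mul] at key
      calc ∑ b, G.incidence R h t b u * (actCoeff R h t G.baseArc true a b * w a)
          = ∑ b, actCoeff R h t G.baseArc true a b * G.incidence R h t b u * w a :=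
            Finset.sum_congr rfl fun b _ ↦ by ring
        _ = ∑ b, G.incidence R h t a b * actCoeff R h t G.baseArc true b u * w a := key
        _ = ∑ b, actCoeff R h t G.baseArc true b u * (G.incidence R h t a b * w a) :=
            Finset.sum_congr rfl fun b _ ↦ by ring
    · -- `u ⊗ X`
      rw [totalD_curl_one_loop_true, curlPosF_loop_true, totalD_apply]
      simp
  · -- the `1`-smoothed curl: unit and `X` cancel
    rw [totalD_curl_one_thru, curlPosF_thru, curlPosF_loop_false]
    simp only [curlPosF_loop_true, curlPosF_thru, mul_zero, Finset.sum_const_zero, add_zero, mul_neg,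
      Finset.mul_sum]
    rw [neg_add_eq_sub, sub_eq_zero]
    refine Finset.sum_congr rfl fun s _ ↦ ?_
    rw [← mul_assoc, negOnePow_weight_mul_actCoeff]

/-- **`F B - 1 = d' H + H d'`.** Khovanov (2000), §5.2; Bar-Natan (2002), §4 (the homotopy of
the cancellation). [cite: BarNatan2002, §4] -/
theorem curlPosF_curlPosB_sub (v : (G.curl tf 1).EnhancedState → R) :
    G.curlPosF tf h t (G.curlPosB tf v) - v =
      (G.curl tf 1).totalD R h t (G.curlPosH tf v) + G.curlPosH tf ((G.curl tf 1).totalD R h t v) := by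
  funext y
  simp only [Pi.sub_apply, Pi.add_apply]
  rcases eq_curlLoopES_or_eq_curlThruES tf 1 y with ⟨u, x, rfl⟩ | ⟨u, rfl⟩
  · cases x
    · -- `u ⊗ 1`
      rw [curlPosF_loop_false, totalD_curl_one_loop_false, curlPosH_loop_false, totalD_curl_one_thru]
      simp only [curlPosB_apply, curlPosH_loop_false]
      have hthru : ∑ s, G.incidence R h t s u * -((-1) ^ s.state.weight * v (curlThruES tf 1 s)) +
          -((-1) ^ u.state.weight * ∑ s, G.incidence R h t s u * v (curlThruES tf 1 s)) = 0 := by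
        rw [Finset.mul_sum, ← Finset.sum_neg_distrib, ← Finset.sum_add_distrib]
        refine Finset.sum_eq_zero fun s _ ↦ ?_
        have := negOnePow_weight_mul_incidence h t s u
        linear_combination (-(v (curlThruES tf 1 s))) * this
      have hX : (-1) ^ u.state.weight * ∑ s, (-1) ^ s.state.weight * actCoeff R h t G.baseArc true s u *
          v (curlLoopES tf 1 s true) = ∑ s, actCoeff R h t G.baseArc true s u * v (curlLoopES tf 1 s true) := by
        rw [Finset.mul_sum]
        refine Finset.sum_congr rfl fun s _ ↦ ?_
        have h1 := negOnePow_weight_mul_actCoeff h t G.baseArc true s u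
        have h2 := negOnePow_mul_self (R := R) s.state.weight
        linear_combination (v (curlLoopES tf 1 s true)) * ((-1) ^ s.state.weight * h1) +
          (actCoeff R h t G.baseArc true s u * v (curlLoopES tf 1 s true)) * h2
      have hu := negOnePow_mul_self (R := R) u.state.weight
      linear_combination -hthru + hX + (v (curlLoopES tf 1 u false)) * hu
    · -- `u ⊗ X`
      rw [curlPosF_loop_true, curlPosB_apply, totalD_curl_one_loop_true, curlPosH_loop_true]
      simp
  · -- the `1`-smoothed curl
    rw [curlPosF_thru, totalD_curl_one_thru, curlPosH_thru]
    simp only [curlPosH_loop_false, curlPosH_loop_true, curlPosH_thru, mul_zero, Finset.sum_const_zero,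
      add_zero, zero_sub]
    have hu := negOnePow_mul_self (R := R) u.state.weight
    linear_combination (v (curlThruES tf 1 u)) * hu

variable (G)

/-- **The homotopy data of the positive curl.** [folklore] -/
def curlPosHtpy : HtpyData R G (G.curl tf 1) h t where
  F := G.curlPosF tf h t
  B := G.curlPosB tf
  H := G.curlPosH tf
  F_comm := totalD_curlPosF tf h t
  B_comm := totalD_curlPosB tf h t
  B_F := curlPosB_curlPosF tf h t
  F_B := curlPosF_curlPosB_sub tf h t

variable {G}

/-! ### Degrees -/

/-- `F` preserves the homological degree. [folklore] -/
theorem suppDeg_curlPosF (i : ℤ) (w : G.EnhancedState → R) (hw : SuppDeg i w) :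
    SuppDeg i (G.curlPosF tf h t w) := by
  intro y hy
  rcases eq_curlLoopES_or_eq_curlThruES tf 1 y with ⟨u, x, rfl⟩ | ⟨u, rfl⟩
  · rw [homDegree_curlLoopES] at hy
    cases x
    · rw [curlPosF_loop_false, neg_eq_zero]
      refine Finset.sum_eq_zero fun s _ ↦ ?_
      by_cases h0 : actCoeff R h t G.baseArc true s u = 0
      · rw [h0, zero_mul]
      · rw [hw s (by rw [homDegree, ← state_eq_of_actCoeff_ne_zero R h0]; exact hy), mul_zero]
    · rw [curlPosF_loop_true, hw u hy]
  · exact curlPosF_thru tf w u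

/-- `B` preserves the homological degree. [folklore] -/
theorem suppDeg_curlPosB (i : ℤ) (v : (G.curl tf 1).EnhancedState → R) (hv : SuppDeg i v) :
    SuppDeg i (G.curlPosB tf v) := fun s hs ↦
  hv _ (by rw [homDegree_curlLoopES]; exact hs)

/-- `H` lowers the homological degree by one. [folklore] -/
theorem suppDeg_curlPosH (i : ℤ) (v : (G.curl tf 1).EnhancedState → R) (hv : SuppDeg i v) :
    SuppDeg (i - 1) (G.curlPosH tf v) := by
  intro y hy
  rcases eq_curlLoopES_or_eq_curlThruES tf 1 y with ⟨u, x, rfl⟩ | ⟨u, rfl⟩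
  · cases x
    · rw [curlPosH_loop_false, hv _ (fun h' ↦ hy ?_), mul_zero, neg_zero]
      rw [homDegree_curlLoopES]
      rw [homDegree_curlThruES] at h'
      push_cast at h'
      linarith
    · exact curlPosH_loop_true tf v u
  · exact curlPosH_thru tf v u

/-- **Khovanov homology over the universal Frobenius system is invariant under a positive curl**,
for every Gauss diagram and every `(R, h, t)` (in particular Lee homology).
Khovanov (2000), §5.2, Thm. 1; Khovanov (2006), Prop. 6; Bar-Natan (2002), §4. [cite: Khovanov2000, §5.2] -/
theorem nonempty_iso_frobeniusHomology_curl_one (i : ℤ) :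
    Nonempty (G.frobeniusHomology R h t i ≅ (G.curl tf 1).frobeniusHomology R h t i) :=
  (G.curlPosHtpy tf h t).nonempty_iso_frobeniusHomology (suppDeg_curlPosF tf h t)
    (suppDeg_curlPosB tf) (suppDeg_curlPosH tf) i

/-! ### Bidegrees (integral theory, `h = t = 0`) -/

/-- A nonzero `X`-action coefficient at `h = t = 0` means: the circle of `α` was labelled `1` in
`s` and `u` is `s` with that circle relabelled `X` (`actX`). [folklore] -/
theorem eq_actX_of_actCoeff_ne_zero {α : G.Arc} {s u : G.EnhancedState}
    (h0 : actCoeff ℤ 0 0 α true s u ≠ 0) : s.label α = false ∧ u = s.actX α := by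
  unfold actCoeff at h0
  split_ifs at h0 with hc
  · obtain ⟨hst, hoff⟩ := hc
    have hl : s.label α = false ∧ u.label α = true := by
      revert h0
      cases s.label α <;> cases u.label α <;> simp [mergeCoeff]
    refine ⟨hl.1, EnhancedState.ext' hst (funext fun c ↦ ?_)⟩
    rw [EnhancedState.actX_label]
    by_cases hr : (G.stateGraph s.state).Reachable α c
    · rw [if_pos hr, s.label_eq_of_reachable hr.symm, hl.1]
      have : u.label c = u.label α := u.label_eq_of_reachable (by rw [hst]; exact hr.symm)
      rw [this, hl.2]; rfl
    · rw [if_neg hr]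
      exact hoff c (fun hc ↦ hr (circleOf_eq_iff.1 hc).symm)
  · exact (h0 rfl).elim

/-- At `h = t = 0`, multiplication by `X` lowers the quantum degree by `2`. [folklore] -/
theorem qDegree_eq_of_actCoeff_ne_zero {α : G.Arc} {s u : G.EnhancedState}
    (h0 : actCoeff ℤ 0 0 α true s u ≠ 0) : qDegree u = qDegree s - 2 := by
  obtain ⟨hl, rfl⟩ := eq_actX_of_actCoeff_ne_zero h0
  rw [qDegree_actX, hl, labelDeg_false, mul_one]

/-- `F` has bidegree `(0, 0)` at `h = t = 0`. [folklore] -/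
theorem suppBideg_curlPosF (i j : ℤ) (w : G.EnhancedState → ℤ) (hw : SuppBideg i j w) :
    SuppBideg i j (G.curlPosF tf 0 0 w) := by
  intro y hy
  rcases eq_curlLoopES_or_eq_curlThruES tf 1 y with ⟨u, x, rfl⟩ | ⟨u, rfl⟩
  · rw [homDegree_curlLoopES, qDegree_curlLoopES] at hy
    cases x
    · rw [curlPosF_loop_false, neg_eq_zero]
      refine Finset.sum_eq_zero fun s _ ↦ ?_
      by_cases h0 : actCoeff ℤ 0 0 G.baseArc true s u = 0
      · rw [h0, zero_mul]
      · rw [hw s (fun hs ↦ hy ⟨?_, ?_⟩), mul_zero]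
        · rw [homDegree, state_eq_of_actCoeff_ne_zero ℤ h0]; exact hs.1
        · rw [qDegree_eq_of_actCoeff_ne_zero h0, hs.2, labelDeg_false]; push_cast; ring
    · rw [curlPosF_loop_true, hw u (fun hu ↦ hy ⟨hu.1, ?_⟩)]
      rw [hu.2, labelDeg_true]; push_cast; ring
  · exact curlPosF_thru tf w u

/-- `B` has bidegree `(0, 0)`. [folklore] -/
theorem suppBideg_curlPosB (i j : ℤ) (v : (G.curl tf 1).EnhancedState → ℤ) (hv : SuppBideg i j v) :
    SuppBideg i j (G.curlPosB tf v) := fun s hs ↦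
  hv _ (fun h' ↦ hs (by
    rw [homDegree_curlLoopES, qDegree_curlLoopES, labelDeg_true] at h'
    push_cast at h'
    exact ⟨h'.1, by linarith [h'.2]⟩))

/-- `H` has bidegree `(-1, 0)`. [folklore] -/
theorem suppBideg_curlPosH (i j : ℤ) (v : (G.curl tf 1).EnhancedState → ℤ) (hv : SuppBideg i j v) :
    SuppBideg (i - 1) j (G.curlPosH tf v) := by
  intro y hy
  rcases eq_curlLoopES_or_eq_curlThruES tf 1 y with ⟨u, x, rfl⟩ | ⟨u, rfl⟩
  · cases x
    · rw [curlPosH_loop_false, hv _ (fun h' ↦ hy ?_), mul_zero, neg_zero]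
      rw [homDegree_curlLoopES, qDegree_curlLoopES, labelDeg_false]
      rw [homDegree_curlThruES, qDegree_curlThruES] at h'
      push_cast at h' ⊢
      exact ⟨by linarith [h'.1], by linarith [h'.2]⟩
    · exact curlPosH_loop_true tf v u
  · exact curlPosH_thru tf v u

/-- **Integral Khovanov homology is invariant under a positive curl, in every bidegree and for
every Gauss diagram**: `Kh^{i,j}(G) ≅ Kh^{i,j}(G.curl tf 1)`. Khovanov (2000), §5.2 and Thm. 1;
Bar-Natan (2002), §4, Thm. 1. [cite: Khovanov2000, Thm. 1] -/
theorem nonempty_iso_khovanovHomology_curl_one (i j : ℤ) :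
    Nonempty (G.khovanovHomology i j ≅ (G.curl tf 1).khovanovHomology i j) :=
  (G.curlPosHtpy tf 0 0).nonempty_iso_khovanovHomology (suppBideg_curlPosF tf)
    (suppBideg_curlPosB tf) (suppBideg_curlPosH tf) i j

end Pos

end GaussDiagram

end Literature.Topology.FourManifolds
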